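import Literature.NumberTheory.Sieve.HeathBrownCubicTypeIIAllLargeC
import HarnessLib

/-!
# Heath-Brown's theorem on primes `x³ + 2y³` for EVERY large box exponent `c`, II: (2.4) and (2.2)

Sequel of `HeathBrownCubicTypeIIAllLargeC` (D. R. Heath-Brown, *Primes represented by `x³ + 2y³`*, Acta
Math. 186 (2001) 1–84, Theorem 1 / (2.2) with the box exponent free).  From the all-large-`c` Type II block
(`CubicSieve.HeathBrown2001_typeII_terms_allLargeC`) and the tree's `η`-uniform Lemmas 3.4, 3.5, 3.6 this
pure-proof file (no definitions, no named facts) derives, by the per-`c` bookkeeping already in the tree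
(`HeathBrown2001_sieveComparison_of`, `HeathBrown2001_primePairCount_asymptotic_of`):

* `CubicSieve.HeathBrown2001_sieveComparison_at` — (2.4) at ONE exponent `c` from the Type II bound at `c`;
  `CubicSieve.HeathBrown2001_sieveComparison_allLargeC` — (2.4) for every `c ≥ c₀(σ₀)`;
* `CubicPrimes.HeathBrown2001_primePairCount_asymptotic_at` — (2.2) at ONE `c` from (2.4) at `c`, (2.3)
  and the singular product; **`CubicPrimes.HeathBrown2001_primePairCount_asymptotic_allLargeC`** — there are
  `c₀ > 0` and `σ₀ > 0` (the limit of the ordered partial singular products) such that for EVERY `c ≥ c₀`,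
  with `η = (log X)^{−c}`, `π(𝒜) − σ₀η²X²/(3 log X) = O(σ₀η²X²/(3 log X)·(log log X)^{−1/6})`; and the
  `(1 + o(1))` form `CubicPrimes.HeathBrown2001_primePairCount_isLittleO_allLargeC` (the `d = 1` rung
  "admissible box exponents form an up-set" of the residue-class programme for Heath-Brown–Moroz 2004).

## References

* D. R. Heath-Brown, *Primes represented by `x³ + 2y³`*, Acta Math. 186 (2001) 1–84: Theorem 1, §2
  (2.2)–(2.4) pp. 4–5, §3 (3.15) and p. 21. [cite: HeathBrownActa2001, Theorem 1 and (2.2)]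

## Mathlib / tree search

Tree (all PROVED): `HeathBrown2001_typeII_terms_allLargeC` (part I), `HeathBrown2001_lemma_3_4`,
`HeathBrown2001_lemma_3_5_holds`, `HeathBrown2001_lemma_3_6_holds`, `eventually_params`, `sqrt_window_le`
(`HeathBrownCubicSieveDecomposition(Proofs)`, `…Lemma35Holds`, `…PrimesFrontier`),
`eventually_abs_normPrimeCount_sub_le`, `HeathBrown2001_firstDegreePIT_holds`,
`HeathBrown2001_singularProduct_holds`, `kappa_def`, `mainTerm_pos`, `mainTerm_mul_loglog_isLittleO`
(`HeathBrownCubicPrimesOutline(Proofs)`, `…PrimesProofs`, `HeathBrownMorozResidueClasses` is NOT imported —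
the `o`-form is re-derived in two lines). `lean search 'sieveComparison_at|asymptotic_allLargeC'`: no hits.
-/

noncomputable section

open Polynomial NumberField Finset Filter Topology Asymptotics

namespace Literature.NumberTheory.Sieve.CubicSieve

open LFunctions.CubeRootTwoField CubicPrimes

/-! ### (2.4) at a given exponent -/

/-- **(2.4) at ONE exponent `c`** from the Type II bound at `c` (and the tree's Lemmas 3.4, 3.5, 3.6):
the bookkeeping of `HeathBrown2001_sieveComparison_of`, per `c`. [cite: HeathBrownActa2001, §3 (3.15) and p. 21] -/
theorem HeathBrown2001_sieveComparison_at {σ₀ : ℝ} (hσ : Tendsto singularProductPartial atTop (𝓝 σ₀))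
    {c : ℝ} (hc : 0 < c)
    (hII : ∃ C X₀ : ℝ, ∀ X : ℝ, X₀ ≤ X →
      |(U1piece (boxPairs X (Real.log X ^ (-c))) pairIdeal X (hbTau (1 / 6) X) 1 : ℝ) -
          kappa σ₀ X (Real.log X ^ (-c)) *
            U1piece (normWindow X (Real.log X ^ (-c))) (fun J => J) X (hbTau (1 / 6) X) 1|
      + |(U1piece (boxPairs X (Real.log X ^ (-c))) pairIdeal X (hbTau (1 / 6) X) 2 : ℝ) -
          kappa σ₀ X (Real.log X ^ (-c)) *
            U1piece (normWindow X (Real.log X ^ (-c))) (fun J => J) X (hbTau (1 / 6) X) 2|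
      + ∑ n ∈ Icc 3 (chainBound (hbTau (1 / 6) X)),
          |(Upiece (boxPairs X (Real.log X ^ (-c))) pairIdeal X (hbTau (1 / 6) X) n : ℝ) -
            kappa σ₀ X (Real.log X ^ (-c)) *
              Upiece (normWindow X (Real.log X ^ (-c))) (fun J => J) X (hbTau (1 / 6) X) n|
      + |(U2one (boxPairs X (Real.log X ^ (-c))) pairIdeal X (hbTau (1 / 6) X) : ℝ) -
          kappa σ₀ X (Real.log X ^ (-c)) *
            U2one (normWindow X (Real.log X ^ (-c))) (fun J => J) X (hbTau (1 / 6) X)|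
      + |(S₄ (boxPairs X (Real.log X ^ (-c))) pairIdeal X (hbTau (1 / 6) X) : ℝ) -
          kappa σ₀ X (Real.log X ^ (-c)) *
            S₄ (normWindow X (Real.log X ^ (-c))) (fun J => J) X (hbTau (1 / 6) X)| ≤
        C * hbTau (1 / 6) X * (Real.log X ^ (-c)) ^ 2 * X ^ 2 / Real.log X) :
    (fun X : ℝ => (primePairCount X (Real.log X ^ (-c)) : ℝ) -
        kappa σ₀ X (Real.log X ^ (-c)) * normPrimeCount X (Real.log X ^ (-c))) =O[atTop]
      fun X : ℝ => (Real.log X ^ (-c)) ^ 2 * X ^ 2 / Real.log X *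
        Real.log (Real.log X) ^ (-(1 / 6 : ℝ)) := by
  have hσ0 : 0 ≤ σ₀ := ge_of_tendsto' hσ fun N => (singularProductPartial_pos N).le
  obtain ⟨CII, XII, hIIb⟩ := hII
  obtain ⟨C5, X5, h5⟩ := HeathBrown2001_lemma_3_5_holds σ₀ hσ (1 / 6) (by norm_num) (by norm_num)
  obtain ⟨C6, X6, h6⟩ := HeathBrown2001_lemma_3_6_holds σ₀ hσ (1 / 6) (by norm_num) (by norm_num)
  rw [isBigO_iff]
  refine ⟨1 + |C5| + 4 * |C6| + |CII|, ?_⟩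
  filter_upwards [eventually_params hc (3 * σ₀), eventually_ge_atTop X5, eventually_ge_atTop X6,
    eventually_ge_atTop XII] with X hP hX5 hX6 hXII
  obtain ⟨hX2, hη0, hη10, hηexp, hτ0, hτ4, hfirst⟩ := hP
  set L := Real.log X with hL
  set η := L ^ (-c) with hη
  set τ := hbTau (1 / 6) X with hτdef
  set κ := kappa σ₀ X η with hκ
  have hX0 : 0 < X := by linarith
  have hX1 : 1 ≤ X := by linarith
  have hLpos : 0 < L := Real.log_pos (by linarith)
  have hκ0 : 0 ≤ κ := by rw [hκ, kappa]; positivity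
  have h34 := HeathBrown2001_lemma_3_4 (κ := κ) hX2 hη0.le hη10 hτ0 hτ4 hκ0
  have h5X := h5 X η hX5 hηexp (by linarith)
  obtain ⟨h63, h65, h66, h67⟩ := h6 X η hX6 hηexp (by linarith)
  have hIIX := hIIb X hXII
  set B := τ * η ^ 2 * X ^ 2 / L with hB
  have hB0 : 0 ≤ B := by rw [hB]; positivity
  have hfirst' : κ * (3 * (Real.sqrt (3 * X ^ 3 * (1 + η)) + 1)) ≤ B := by
    have hsq := sqrt_window_le hX0.le (by linarith : η ≤ 1 / 3)
    have hX12 : 0 < X ^ (1 / 2 : ℝ) := Real.rpow_pos_of_pos hX0 _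
    have hX32 : X ^ (3 / 2 : ℝ) = X * X ^ (1 / 2 : ℝ) := by
      rw [← Real.rpow_one_add' hX0.le (by norm_num)]; norm_num
    have hX12ge : 1 ≤ X ^ (1 / 2 : ℝ) := Real.one_le_rpow hX1 (by norm_num)
    have h1 : Real.sqrt (3 * X ^ 3 * (1 + η)) + 1 ≤ 3 * X * X ^ (1 / 2 : ℝ) := by
      rw [hX32] at hsq; nlinarith
    calc κ * (3 * (Real.sqrt (3 * X ^ 3 * (1 + η)) + 1))
        ≤ κ * (3 * (3 * X * X ^ (1 / 2 : ℝ))) := by gcongr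
      _ = 3 * σ₀ * η * X ^ (1 / 2 : ℝ) := by rw [hκ, kappa]; field_simp
      _ ≤ B := hfirst
  have h5' := h5X.trans (by
    show C5 * τ * η ^ 2 * X ^ 2 / L ≤ |C5| * B
    rw [hB, show C5 * τ * η ^ 2 * X ^ 2 / L = C5 * (τ * η ^ 2 * X ^ 2 / L) by ring]
    exact mul_le_mul_of_nonneg_right (le_abs_self _) hB0)
  have hC6B : C6 * τ * η ^ 2 * X ^ 2 / L ≤ |C6| * B := by
    rw [hB, show C6 * τ * η ^ 2 * X ^ 2 / L = C6 * (τ * η ^ 2 * X ^ 2 / L) by ring]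
    exact mul_le_mul_of_nonneg_right (le_abs_self _) hB0
  have hII' := hIIX.trans (by
    show CII * τ * η ^ 2 * X ^ 2 / L ≤ |CII| * B
    rw [hB, show CII * τ * η ^ 2 * X ^ 2 / L = CII * (τ * η ^ 2 * X ^ 2 / L) by ring]
    exact mul_le_mul_of_nonneg_right (le_abs_self _) hB0)
  have h63' := h63.trans hC6B
  have h65' := h65.trans hC6B
  have h66' := h66.trans hC6B
  have h67' := h67.trans hC6B
  have hg : η ^ 2 * X ^ 2 / L * Real.log L ^ (-(1 / 6 : ℝ)) = B := by
    rw [hB, hτdef, hbTau, ← hL]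
    ring
  rw [Real.norm_eq_abs, Real.norm_eq_abs, hg, abs_of_nonneg hB0]
  refine h34.trans ?_
  linarith [hfirst', h5', h63', h65', h66', h67', hII']

/-- **(2.4) for EVERY box exponent `c ≥ c₀`**: for the limit `σ₀` of the partial singular products there
is `c₀ > 0` with `π(𝒜) − κπ(ℬ) = O_c(η²X²(log X)^{−1}(log log X)^{−1/6})` for all `c ≥ c₀`,
`η = (log X)^{−c}`, `κ = σ₀η/(3X)`. [cite: HeathBrownActa2001, §2 (2.4) and p. 21] -/
theorem HeathBrown2001_sieveComparison_allLargeC :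
    ∀ σ₀ : ℝ, Tendsto singularProductPartial atTop (𝓝 σ₀) → ∃ c₀ : ℝ, 0 < c₀ ∧ ∀ c : ℝ, c₀ ≤ c →
      (fun X : ℝ => (primePairCount X (Real.log X ^ (-c)) : ℝ) -
          kappa σ₀ X (Real.log X ^ (-c)) * normPrimeCount X (Real.log X ^ (-c))) =O[atTop]
        fun X : ℝ => (Real.log X ^ (-c)) ^ 2 * X ^ 2 / Real.log X *
          Real.log (Real.log X) ^ (-(1 / 6 : ℝ)) := by
  intro σ₀ hσ
  obtain ⟨c₀, hc₀, h⟩ := HeathBrown2001_typeII_terms_allLargeC σ₀ hσ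
  exact ⟨c₀, hc₀, fun c hc => HeathBrown2001_sieveComparison_at hσ (hc₀.trans_le hc) (h c hc)⟩

end Literature.NumberTheory.Sieve.CubicSieve

namespace Literature.NumberTheory.Sieve.CubicPrimes

/-! ### (2.2) at a given exponent, and for every large exponent -/

/-- **(2.2) at ONE exponent `c`** from (2.4) at `c`, the prime ideal theorem (2.3) and `σ₀ > 0`: the
bookkeeping of `HeathBrown2001_primePairCount_asymptotic_of`, per `c`
(`π(𝒜) − M = (π(𝒜) − κπ(ℬ)) + κ(π(ℬ) − ηX³/log X)`, `κηX³/log X = M`). [cite: HeathBrownActa2001, §2 pp. 4–5] -/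
theorem HeathBrown2001_primePairCount_asymptotic_at {σ₀ : ℝ} (hσ₀ : 0 < σ₀) {c : ℝ} (hc : 0 < c)
    (hO : (fun X : ℝ => (primePairCount X (Real.log X ^ (-c)) : ℝ) -
        kappa σ₀ X (Real.log X ^ (-c)) * normPrimeCount X (Real.log X ^ (-c))) =O[atTop]
      fun X : ℝ => (Real.log X ^ (-c)) ^ 2 * X ^ 2 / Real.log X *
        Real.log (Real.log X) ^ (-(1 / 6 : ℝ))) :
    (fun X : ℝ => (primePairCount X (Real.log X ^ (-c)) : ℝ) - mainTerm c σ₀ X) =O[atTop]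
      fun X : ℝ => mainTerm c σ₀ X * Real.log (Real.log X) ^ (-(1 / 6 : ℝ)) := by
  obtain ⟨C₁, hC₁⟩ := hO.bound
  have hB := eventually_abs_normPrimeCount_sub_le HeathBrown2001_firstDegreePIT_holds hc
  refine IsBigO.of_bound (3 * ‖C₁‖ / σ₀ + 2) ?_
  filter_upwards [hC₁, hB, eventually_ge_atTop (2 : ℝ),
    Real.tendsto_log_atTop.eventually (eventually_ge_atTop (1 : ℝ)),
    (Real.tendsto_log_atTop.comp Real.tendsto_log_atTop).eventually (eventually_ge_atTop (1 : ℝ))]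
    with X hC₁X hBX hX2 hL1 hLL1
  set L := Real.log X with hL
  set η := L ^ (-c) with hη
  set ℓ := Real.log L ^ (-(1 / 6 : ℝ)) with hℓ
  have hLL1' : 1 ≤ Real.log L := by simpa [Function.comp_def] using hLL1
  have hX0 : 0 < X := by linarith
  have hX1 : 1 < X := by linarith
  have hLpos : 0 < L := by linarith
  have hη0 : 0 < η := Real.rpow_pos_of_pos hLpos _
  have hℓ0 : 0 < ℓ := Real.rpow_pos_of_pos (by linarith) _
  have hM : 0 < mainTerm c σ₀ X := mainTerm_pos hσ₀ hX1
  have hMdef : mainTerm c σ₀ X = σ₀ * η ^ 2 * X ^ 2 / (3 * L) := rfl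
  have hLℓ : L⁻¹ ≤ ℓ := by
    rw [hℓ, Real.rpow_neg (by linarith)]
    refine inv_anti₀ (Real.rpow_pos_of_pos (by linarith) _) ?_
    calc Real.log L ^ (1 / 6 : ℝ) ≤ Real.log L ^ (1 : ℝ) :=
          Real.rpow_le_rpow_of_exponent_le hLL1' (by norm_num)
      _ = Real.log L := Real.rpow_one _
      _ ≤ L := Real.log_le_self hLpos.le
  have hE1 : ‖(η ^ 2 * X ^ 2 / L * ℓ : ℝ)‖ = 3 / σ₀ * (mainTerm c σ₀ X * ℓ) := by
    rw [Real.norm_of_nonneg (by positivity), hMdef]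
    field_simp
  have hκ : kappa σ₀ X η * (η * X ^ 3 / L) = mainTerm c σ₀ X := by
    rw [kappa_def, hMdef]; field_simp
  have hκ' : kappa σ₀ X η * (2 * (η * X ^ 3 / L ^ 2)) = 2 * mainTerm c σ₀ X * L⁻¹ := by
    rw [kappa_def, hMdef]; field_simp
  have hκ0 : 0 ≤ kappa σ₀ X η := by rw [kappa_def]; positivity
  have hdec : (primePairCount X η : ℝ) - mainTerm c σ₀ X =
      ((primePairCount X η : ℝ) - kappa σ₀ X η * normPrimeCount X η) +
        kappa σ₀ X η * ((normPrimeCount X η : ℝ) - η * X ^ 3 / L) := by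
    rw [mul_sub, hκ]; ring
  rw [Real.norm_eq_abs, hdec, Real.norm_of_nonneg (by positivity : (0 : ℝ) ≤ mainTerm c σ₀ X * ℓ)]
  calc |((primePairCount X η : ℝ) - kappa σ₀ X η * normPrimeCount X η) +
          kappa σ₀ X η * ((normPrimeCount X η : ℝ) - η * X ^ 3 / L)|
      ≤ |(primePairCount X η : ℝ) - kappa σ₀ X η * normPrimeCount X η| +
          kappa σ₀ X η * |(normPrimeCount X η : ℝ) - η * X ^ 3 / L| := by
        refine (abs_add_le _ _).trans (add_le_add le_rfl ?_)
        rw [abs_mul, abs_of_nonneg hκ0]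
    _ ≤ C₁ * ‖(η ^ 2 * X ^ 2 / L * ℓ : ℝ)‖ + kappa σ₀ X η * (2 * (η * X ^ 3 / L ^ 2)) := by
        have h1 : |(primePairCount X η : ℝ) - kappa σ₀ X η * normPrimeCount X η| ≤
            C₁ * ‖(η ^ 2 * X ^ 2 / L * ℓ : ℝ)‖ := by simpa only [Real.norm_eq_abs] using hC₁X
        gcongr
    _ ≤ ‖C₁‖ * ‖(η ^ 2 * X ^ 2 / L * ℓ : ℝ)‖ + kappa σ₀ X η * (2 * (η * X ^ 3 / L ^ 2)) := by
        gcongr; exact Real.le_norm_self _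
    _ = 3 * ‖C₁‖ / σ₀ * (mainTerm c σ₀ X * ℓ) + 2 * mainTerm c σ₀ X * L⁻¹ := by
        rw [hE1, hκ']; ring
    _ ≤ 3 * ‖C₁‖ / σ₀ * (mainTerm c σ₀ X * ℓ) + 2 * mainTerm c σ₀ X * ℓ := by
        gcongr
    _ = (3 * ‖C₁‖ / σ₀ + 2) * (mainTerm c σ₀ X * ℓ) := by ring

/-- **Heath-Brown's Theorem (2.2) for EVERY large box exponent**: there are `c₀ > 0` and `σ₀ > 0`, the
limit of the ordered partial products of the singular series, such that for every `c ≥ c₀`, with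
`η = (log X)^{−c}`, `π(𝒜) = σ₀η²X²/(3 log X)·{1 + O_c((log log X)^{−1/6})}` as `X → ∞`.  (The tree's
`HeathBrown2001_primePairCount_asymptotic_holds` is the instance `c = c₀`.)
[cite: HeathBrownActa2001, Theorem 1 and (2.2)] -/
theorem HeathBrown2001_primePairCount_asymptotic_allLargeC :
    ∃ c₀ : ℝ, 0 < c₀ ∧ ∃ σ₀ : ℝ, 0 < σ₀ ∧ Tendsto singularProductPartial atTop (𝓝 σ₀) ∧
      ∀ c : ℝ, c₀ ≤ c →
        (fun X : ℝ => (primePairCount X (Real.log X ^ (-c)) : ℝ) - mainTerm c σ₀ X) =O[atTop]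
          fun X : ℝ => mainTerm c σ₀ X * Real.log (Real.log X) ^ (-(1 / 6 : ℝ)) := by
  obtain ⟨σ₀, hσ₀, hlim⟩ := HeathBrown2001_singularProduct_holds
  obtain ⟨c₀, hc₀, h⟩ := CubicSieve.HeathBrown2001_sieveComparison_allLargeC σ₀ hlim
  exact ⟨c₀, hc₀, σ₀, hσ₀, hlim, fun c hc =>
    HeathBrown2001_primePairCount_asymptotic_at hσ₀ (hc₀.trans_le hc) (h c hc)⟩

/-- **The `(1 + o(1))` form for every large box exponent** ("admissible box exponents form an up-set"):
`∃ c₀ > 0, ∃ σ₀ > 0` (the singular series) with `π(𝒜)(X, (log X)^{−c}) − σ₀η²X²/(3 log X) = o(σ₀η²X²/(3 log X))`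
for EVERY `c ≥ c₀`. [cite: HeathBrownActa2001, Theorem 1 and (2.2)] -/
theorem HeathBrown2001_primePairCount_isLittleO_allLargeC :
    ∃ c₀ : ℝ, 0 < c₀ ∧ ∃ σ₀ : ℝ, 0 < σ₀ ∧ Tendsto singularProductPartial atTop (𝓝 σ₀) ∧
      ∀ c : ℝ, c₀ ≤ c →
        (fun X : ℝ => (primePairCount X (Real.log X ^ (-c)) : ℝ) - mainTerm c σ₀ X) =o[atTop]
          fun X : ℝ => mainTerm c σ₀ X := by
  obtain ⟨c₀, hc₀, σ₀, hσ₀, hlim, h⟩ := HeathBrown2001_primePairCount_asymptotic_allLargeC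
  refine ⟨c₀, hc₀, σ₀, hσ₀, hlim, fun c hc => (h c hc).trans_isLittleO ?_⟩
  have hll : Tendsto (fun X : ℝ => Real.log (Real.log X) ^ (-(1 / 6 : ℝ))) atTop (𝓝 0) :=
    (tendsto_rpow_neg_atTop (by norm_num : (0 : ℝ) < 1 / 6)).comp
      (Real.tendsto_log_atTop.comp Real.tendsto_log_atTop)
  simpa only [mul_one] using (isBigO_refl (fun X : ℝ => mainTerm c σ₀ X) atTop).mul_isLittleO
    ((isLittleO_one_iff ℝ).2 hll)

end Literature.NumberTheory.Sieve.CubicPrimes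

end
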